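import Literature.AlgebraicGeometry.PlaneCurves.HessePencilHessianGroup
import HarnessLib

/-!
# The proof of Artebani–Dolgachev's Proposition 6.1: the sextics `A₁, …, A₄`, the action of
# `g₄`, `Φ₆′ = A₄ − 3(A₁ + ε²A₂ + εA₃)`, and the invariance of `Φ₆′`

Topic `Literature/AlgebraicGeometry/PlaneCurves`, namespace
`Literature.AlgebraicGeometry.PlaneCurves`.
Lane `lit-hodgefound`, seat `lit-hodgefound-p37`, row g19-#8; a one-file sequel of the seat's
`HessePencilCuspidalSextic` (g19-#4: `Φ₆′` has double points at `p₁, …, p₈`, the syzygy, `C₆`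
smooth) and `HessePencilHalphenCubics` (g19-#7).  The source PROVES Prop. 6.1 ("the 8-cuspidal
sextic `C₆′` is projectively equivalent to `Φ₆′ = 0`") by writing down a basis `A₁, …, A₄` of the
space `V` of sextics singular at `p₁, …, p₈`, computing the action of `g₄` on it, and pinning the
invariant combination.  This file formalizes exactly those printed computations: each `Aᵢ` is
singular at the eight points, `g₄` acts as printed, `Φ₆′ = A₄ − 3(A₁ + ε²A₂ + εA₃)` (the constants
`λ = −3`, `μ = 1`, which the source leaves as "a simple computation"), and `Φ₆′` is invariant under
`g₄` and under the `SL(3)`-normalised `g₃`.  Everything here is PROVED; no definition, no named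
  fact.

Source followed — M. Artebani, I. Dolgachev, *The Hesse pencil of plane cubic curves*, Enseign.
Math. 55 (2009) 235–273, §6, proof of Proposition 6.1 [held `paper:arxiv-math_0611590` p0012
L14–L37], VERBATIM (`ε = ω`):

> *Proof.* Since `C₆′` has 8 cusps, it is a rational curve. In particular `C₆ ≠ C₆′`. By Bezout's
> theorem, `C₆′` does not contain the base points `p₀, …, p₈`, hence, by the `Γ`-invariance, we may
> assume that the sextic has cusps at `p₁, …, p₈`. Let `V` be the vector space of homogeneous
> polynomials of degree `6` vanishing at `p₁, …, p₈` with multiplicity `≥ 2`. […] It is easy to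
> see that `V` is spanned by
> `A₁ = yz(x + εy + z)(x + y + εz)(x + ε²y + z)(x + y + ε²z)`,
> `A₂ = yz(x + εy + ε²z)(x + ε²y + εz)(x + y + εz)(x + εy + z)`,
> `A₃ = yz(x + ε²y + z)(x + y + ε²z)(x + εy + ε²z)(x + ε²y + εz)`,
> `A₄ = (x + εy + ε²z)(x + ε²y + εz)(x + y + εz)(x + εy + z)(x + ε²y + z)(x + y + ε²z)`.
> A polynomial `P(x, y, z)` defining the curve `C₆′` is invariant with respect to the linear
> representation of the binary tetrahedral group `T̄ ≅ SL(2, 𝔽₃)` in `V`. […] Applying `g₄` we find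
> that `(A₁, A₂, A₃, A₄) ↦ (ε²A₂, ε²A₃, ε²A₁, A₄)`. Thus `P(x, y, z) = λ(A₁ + ε²A₂ + εA₃) + μA₄`
> for some constants `λ, μ`. Now we apply `g₃` and find `λ, μ` such that `P(x, y, z)` is
> invariant. A simple computation gives the equation of `C₆′`. □

(Prop. 6.1: `Φ₆′ = (x³ + y³ + z³)² − 36y³z³ + 24(z⁴y² + z²y⁴) − 12(z⁵y + zy⁵) − 12x³(z²y + zy²)`;
§4: `g₃ = [[1, 1, 1], [1, ε, ε²], [1, ε², ε]]`, `g₄ = diag(1, ε, ε)`, and the `SL(3)`-lift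
`(ε − ε²)⁻¹g₃`; §2: the base points `p₁ = (0, 1, −ε), p₂ = (0, 1, −ε²), p₃ = (1, 0, −1),
p₄ = (1, 0, −ε²), p₅ = (1, 0, −ε), p₆ = (1, −1, 0), p₇ = (1, −ε, 0), p₈ = (1, −ε², 0)` as in
`HessePencilCuspidalSextic.phi6'_double_points`.)

## Dictionary

* `ω ∈ K` with `ω² + ω + 1 = 0` is `ε`; `Φ₆′`, `𝐀₁[ω], …, 𝐀₄[ω]` are the printed forms (local
  notations, no definitions); a projectivity acts by substitution `F ∘ g := bind₁ g.toMvPolynomial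
    F`.
* "vanishing at `p` with multiplicity `≥ 2`" `:=` `F(p) = 0 ∧ ∇F(p) = 0`.

## What is proved (`K` any field, `ω² + ω + 1 = 0`)

* §1 **`A₁, …, A₄ ∈ V`**: `A₁_double_points, …, A₄_double_points` — each `Aᵢ` vanishes with its
  gradient at `p₁, …, p₈` (at each point two of the six linear factors vanish:
  `double_point_of_two_factors`).
* §2 **"Applying `g₄` we find that `(A₁, A₂, A₃, A₄) ↦ (ε²A₂, ε²A₃, ε²A₁, A₄)`"**: `A₁_bind₁_g₄`
  (`A₁ ∘ g₄ = ε²A₂`), `A₂_bind₁_g₄` (`A₂ ∘ g₄ = ε²A₃`), `A₃_bind₁_g₄` (`A₃ ∘ g₄ = ε²A₁`),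
    `A₄_bind₁_g₄`
  (`A₄ ∘ g₄ = A₄`) — literally as printed, with `F ∘ g₄ = F(x, εy, εz)`.
* §3 **"`P = λ(A₁ + ε²A₂ + εA₃) + μA₄`" with the constants pinned**: `phi6'_eq_A_combination` —
  `Φ₆′ = A₄ − 3(A₁ + ε²A₂ + εA₃)` (`λ = −3`, `μ = 1`).
* §4 **the invariance**: `phi6'_bind₁_g₄` (`Φ₆′ ∘ g₄ = Φ₆′`) and `phi6'_bind₁_g₃`
  (`Φ₆′ ∘ g₃ = −27·Φ₆′`; since `(ε − ε²)⁶ = −27`, this is `Φ₆′ ∘ ((ε − ε²)⁻¹g₃) = Φ₆′` for the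
  `SL(3)`-lift of §4 of the source).

NOT here: that `dim V = 4` (so that `A₁, …, A₄` SPAN `V`), the representation theory of `T̄`, and
the identification of `C₆′ = C₆/Γ` with `Φ₆′ = 0` itself (Prop. 6.1 proper).

## References

* [ArtebaniDolgachev2009] M. Artebani, I. Dolgachev, *The Hesse pencil of plane cubic curves*,
  Enseign. Math. (2) 55 (2009) 235–273, §6, Proposition 6.1 and its proof; §4 (`g₃`, `g₄`).
-/

set_option autoImplicit false

open MvPolynomial Matrix

namespace Literature.AlgebraicGeometry.PlaneCurves

universe u

/-- Artebani–Dolgachev's `Φ₆′ = (x³+y³+z³)² − 36y³z³ + 24(z⁴y² + z²y⁴) − 12(z⁵y + zy⁵) − 12x³(z²y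
  + zy²)`
(Prop. 6.1; local notation as in `HessePencilCuspidalSextic`, no definition). -/
local notation3 "Φ₆'" => ((X 0 ^ 3 + X 1 ^ 3 + X 2 ^ 3) ^ 2 - 36 * (X 1 ^ 3 * X 2 ^ 3) +
  24 * (X 2 ^ 4 * X 1 ^ 2 + X 2 ^ 2 * X 1 ^ 4) - 12 * (X 2 ^ 5 * X 1 + X 2 * X 1 ^ 5) -
  12 * X 0 ^ 3 * (X 2 ^ 2 * X 1 + X 2 * X 1 ^ 2) : MvPolynomial (Fin 3) _)

/-- `A₁ = yz(x + εy + z)(x + y + εz)(x + ε²y + z)(x + y + ε²z)` (Prop. 6.1, proof; local notation,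
no definition). -/
local notation3 "𝐀₁[" ω "]" => (X 1 * X 2 * (X 0 + C ω * X 1 + X 2) * (X 0 + X 1 + C ω * X 2) *
  (X 0 + C (ω ^ 2) * X 1 + X 2) * (X 0 + X 1 + C (ω ^ 2) * X 2) : MvPolynomial (Fin 3) _)

/-- `A₂ = yz(x + εy + ε²z)(x + ε²y + εz)(x + y + εz)(x + εy + z)` (local notation, no definition).
  -/
local notation3 "𝐀₂[" ω "]" => (X 1 * X 2 * (X 0 + C ω * X 1 + C (ω ^ 2) * X 2) *
  (X 0 + C (ω ^ 2) * X 1 + C ω * X 2) * (X 0 + X 1 + C ω * X 2) * (X 0 + C ω * X 1 + X 2) :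
    MvPolynomial (Fin 3) _)

/-- `A₃ = yz(x + ε²y + z)(x + y + ε²z)(x + εy + ε²z)(x + ε²y + εz)` (local notation, no
definition). -/
local notation3 "𝐀₃[" ω "]" => (X 1 * X 2 * (X 0 + C (ω ^ 2) * X 1 + X 2) *
  (X 0 + X 1 + C (ω ^ 2) * X 2) * (X 0 + C ω * X 1 + C (ω ^ 2) * X 2) *
    (X 0 + C (ω ^ 2) * X 1 + C ω * X 2) : MvPolynomial (Fin 3) _)

/-- `A₄ = (x + εy + ε²z)(x + ε²y + εz)(x + y + εz)(x + εy + z)(x + ε²y + z)(x + y + ε²z)` (local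
notation, no definition). -/
local notation3 "𝐀₄[" ω "]" => ((X 0 + C ω * X 1 + C (ω ^ 2) * X 2) *
  (X 0 + C (ω ^ 2) * X 1 + C ω * X 2) * (X 0 + X 1 + C ω * X 2) * (X 0 + C ω * X 1 + X 2) *
    (X 0 + C (ω ^ 2) * X 1 + X 2) * (X 0 + X 1 + C (ω ^ 2) * X 2) : MvPolynomial (Fin 3) _)

section CuspidalSexticBasis

variable {K : Type u} [Field K]

/-! ## §0 Plumbing -/

/-- A product two of whose factors vanish at `p` has a double point at `p` (value and gradient
vanish). [folklore] -/
private theorem double_point_of_two_factors {F G : MvPolynomial (Fin 3) K}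
    (H : MvPolynomial (Fin 3) K) {p : Fin 3 → K} (hF : eval p F = 0) (hG : eval p G = 0) :
    eval p (F * G * H) = 0 ∧ (fun i => eval p (pderiv i (F * G * H))) = 0 := by
  refine ⟨by rw [map_mul, map_mul, hF, zero_mul, zero_mul], funext fun i => ?_⟩
  simp only [Pi.zero_apply, Derivation.leibniz, smul_eq_mul, map_add, map_mul, hF, hG, zero_mul,
    mul_zero, add_zero]

/-- The linear forms of a `3 × 3` substitution, written out. [folklore] -/
private theorem toMvPolynomial_fin_three_c (M : Matrix (Fin 3) (Fin 3) K) (i : Fin 3) :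
    M.toMvPolynomial i = C (M i 0) * X 0 + C (M i 1) * X 1 + C (M i 2) * X 2 := by
  simp only [Matrix.toMvPolynomial, Fin.sum_univ_three, ← C_mul_X_eq_monomial]

/-- `ω² + ω + 1 = 0 ⇒ (C ω)³ = 1` and the relation for `C ω`. [folklore] -/
private theorem C_omega_facts {ω : K} (hω : ω ^ 2 + ω + 1 = 0) :
    (C ω : MvPolynomial (Fin 3) K) ^ 3 = 1 ∧ (C ω : MvPolynomial (Fin 3) K) ^ 2 + C ω + 1 = 0 := by
  have h : ω ^ 3 = 1 := by linear_combination (ω - 1) * hω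
  refine ⟨by rw [← map_pow, h, map_one], ?_⟩
  have h' := congrArg (C : K → MvPolynomial (Fin 3) K) hω
  simpa using h'

/-- Products of the scalars `C ω`, `C ω²` (`ω³ = 1`). [folklore] -/
private theorem C_omega_scalars {ω : K} (hω : ω ^ 2 + ω + 1 = 0) :
    (∀ P : MvPolynomial (Fin 3) K, C ω * (C ω * P) = C (ω ^ 2) * P) ∧
      (∀ P : MvPolynomial (Fin 3) K, C (ω ^ 2) * (C ω * P) = P) ∧
      (∀ P : MvPolynomial (Fin 3) K, C ω * (C (ω ^ 2) * P) = P) ∧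
      (∀ P : MvPolynomial (Fin 3) K, C (ω ^ 2) * (C (ω ^ 2) * P) = C ω * P) := by
  have h3 : ω ^ 3 = 1 := by linear_combination (ω - 1) * hω
  have e1 : ω ^ 2 * ω = 1 := by rw [← pow_succ, h3]
  have e2 : ω * ω ^ 2 = 1 := by rw [mul_comm, e1]
  have e3 : ω ^ 2 * ω ^ 2 = ω := by linear_combination ω * e1
  refine ⟨fun P => ?_, fun P => ?_, fun P => ?_, fun P => ?_⟩
  · rw [← mul_assoc, ← map_mul, ← pow_two]
  · rw [← mul_assoc, ← map_mul, e1, map_one, one_mul]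
  · rw [← mul_assoc, ← map_mul, e2, map_one, one_mul]
  · rw [← mul_assoc, ← map_mul, e3]

/-! ## §1 `A₁, …, A₄` are singular at `p₁, …, p₈` -/

set_option maxHeartbeats 800000 in
/-- **`A₁ ∈ V`**: `A₁` vanishes with multiplicity `≥ 2` at the eight base points
`p₁, …, p₈` (two of its linear factors vanish at each of them; `ω² + ω + 1 = 0`).
[cite: ArtebaniDolgachev2009, §6, Prop. 6.1 (proof: "It is easy to see that `V` is spanned by"
`A₁, …, A₄`)] -/
theorem A₁_double_points {ω : K} (hω : ω ^ 2 + ω + 1 = 0) :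
    ∀ q ∈ [![(0 : K), 1, -ω], ![(0 : K), 1, -ω ^ 2], ![(1 : K), 0, -1], ![(1 : K), 0, -ω ^ 2],
      ![(1 : K), 0, -ω], ![(1 : K), -1, 0], ![(1 : K), -ω, 0], ![(1 : K), -ω ^ 2, 0]],
      eval q (𝐀₁[ω] : MvPolynomial (Fin 3) K) = 0 ∧
        (fun i => eval q (pderiv i (𝐀₁[ω] : MvPolynomial (Fin 3) K))) = 0 := by
  intro q hq
  simp only [List.mem_cons, List.not_mem_nil, or_false] at hq
  rcases hq with rfl | rfl | rfl | rfl | rfl | rfl | rfl | rfl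
  · have e : (𝐀₁[ω] : MvPolynomial (Fin 3) K) =
        (X 0 + C ω * X 1 + X 2) * (X 0 + X 1 + C (ω ^ 2) * X 2) * (X 1 * X 2 * (X 0 + X 1 + C ω *
          X 2) * (X 0 + C (ω ^ 2) * X 1 + X 2)) := by ac_rfl
    rw [e]
    exact double_point_of_two_factors _ (by
        simp only [map_add, map_mul, eval_X, eval_C, Matrix.cons_val_zero, Matrix.cons_val_one,
          Matrix.cons_val_two, Matrix.head_cons, Matrix.tail_cons]
        ring) (by
        simp only [map_add, map_mul, eval_X, eval_C, Matrix.cons_val_zero, Matrix.cons_val_one,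
          Matrix.cons_val_two, Matrix.head_cons, Matrix.tail_cons]
        linear_combination (-(ω) + 1) * hω)
  · have e : (𝐀₁[ω] : MvPolynomial (Fin 3) K) =
        (X 0 + X 1 + C ω * X 2) * (X 0 + C (ω ^ 2) * X 1 + X 2) * (X 1 * X 2 * (X 0 + C ω * X 1 +
          X 2) * (X 0 + X 1 + C (ω ^ 2) * X 2)) := by ac_rfl
    rw [e]
    exact double_point_of_two_factors _ (by
        simp only [map_add, map_mul, eval_X, eval_C, Matrix.cons_val_zero, Matrix.cons_val_one,
          Matrix.cons_val_two, Matrix.head_cons, Matrix.tail_cons]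
        linear_combination (-(ω) + 1) * hω) (by
        simp only [map_add, map_mul, eval_X, eval_C, Matrix.cons_val_zero, Matrix.cons_val_one,
          Matrix.cons_val_two, Matrix.head_cons, Matrix.tail_cons]
        ring)
  · have e : (𝐀₁[ω] : MvPolynomial (Fin 3) K) =
        X 1 * (X 0 + C ω * X 1 + X 2) * (X 2 * (X 0 + X 1 + C ω * X 2) * (X 0 + C (ω ^ 2) * X 1 +
          X 2) * (X 0 + X 1 + C (ω ^ 2) * X
          2)) := by ac_rfl
    rw [e]
    exact double_point_of_two_factors _ (by
        simp only [eval_X, Matrix.cons_val_zero, Matrix.cons_val_one]) (by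
        simp only [map_add, map_mul, eval_X, eval_C, Matrix.cons_val_zero, Matrix.cons_val_one,
          Matrix.cons_val_two, Matrix.head_cons, Matrix.tail_cons]
        ring)
  · have e : (𝐀₁[ω] : MvPolynomial (Fin 3) K) =
        X 1 * (X 0 + X 1 + C ω * X 2) * (X 2 * (X 0 + C ω * X 1 + X 2) * (X 0 + C (ω ^ 2) * X 1 +
          X 2) * (X 0 + X 1 + C (ω ^ 2) * X
          2)) := by ac_rfl
    rw [e]
    exact double_point_of_two_factors _ (by
        simp only [eval_X, Matrix.cons_val_zero, Matrix.cons_val_one]) (by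
        simp only [map_add, map_mul, eval_X, eval_C, Matrix.cons_val_zero, Matrix.cons_val_one,
          Matrix.cons_val_two, Matrix.head_cons, Matrix.tail_cons]
        linear_combination (-(ω) + 1) * hω)
  · have e : (𝐀₁[ω] : MvPolynomial (Fin 3) K) =
        X 1 * (X 0 + X 1 + C (ω ^ 2) * X 2) * (X 2 * (X 0 + C ω * X 1 + X 2) * (X 0 + X 1 + C ω *
          X 2) * (X 0 + C (ω ^ 2) * X 1 + X 2)) := by ac_rfl
    rw [e]
    exact double_point_of_two_factors _ (by
        simp only [eval_X, Matrix.cons_val_zero, Matrix.cons_val_one]) (by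
        simp only [map_add, map_mul, eval_X, eval_C, Matrix.cons_val_zero, Matrix.cons_val_one,
          Matrix.cons_val_two, Matrix.head_cons, Matrix.tail_cons]
        linear_combination (-(ω) + 1) * hω)
  · have e : (𝐀₁[ω] : MvPolynomial (Fin 3) K) =
        X 2 * (X 0 + X 1 + C ω * X 2) * (X 1 * (X 0 + C ω * X 1 + X 2) * (X 0 + C (ω ^ 2) * X 1 +
          X 2) * (X 0 + X 1 + C (ω ^ 2) * X
          2)) := by ac_rfl
    rw [e]
    exact double_point_of_two_factors _ (by
        simp only [eval_X, Matrix.cons_val_two, Matrix.head_cons, Matrix.tail_cons]) (by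
        simp only [map_add, map_mul, eval_X, eval_C, Matrix.cons_val_zero, Matrix.cons_val_one,
          Matrix.cons_val_two, Matrix.head_cons, Matrix.tail_cons]
        ring)
  · have e : (𝐀₁[ω] : MvPolynomial (Fin 3) K) =
        X 2 * (X 0 + C (ω ^ 2) * X 1 + X 2) * (X 1 * (X 0 + C ω * X 1 + X 2) * (X 0 + X 1 + C ω *
          X 2) * (X 0 + X 1 + C (ω ^ 2) * X 2)) := by ac_rfl
    rw [e]
    exact double_point_of_two_factors _ (by
        simp only [eval_X, Matrix.cons_val_two, Matrix.head_cons, Matrix.tail_cons]) (by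
        simp only [map_add, map_mul, eval_X, eval_C, Matrix.cons_val_zero, Matrix.cons_val_one,
          Matrix.cons_val_two, Matrix.head_cons, Matrix.tail_cons]
        linear_combination (-(ω) + 1) * hω)
  · have e : (𝐀₁[ω] : MvPolynomial (Fin 3) K) =
        X 2 * (X 0 + C ω * X 1 + X 2) * (X 1 * (X 0 + X 1 + C ω * X 2) * (X 0 + C (ω ^ 2) * X 1 +
          X 2) * (X 0 + X 1 + C (ω ^ 2) * X
          2)) := by ac_rfl
    rw [e]
    exact double_point_of_two_factors _ (by
        simp only [eval_X, Matrix.cons_val_two, Matrix.head_cons, Matrix.tail_cons]) (by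
        simp only [map_add, map_mul, eval_X, eval_C, Matrix.cons_val_zero, Matrix.cons_val_one,
          Matrix.cons_val_two, Matrix.head_cons, Matrix.tail_cons]
        linear_combination (-(ω) + 1) * hω)

set_option maxHeartbeats 800000 in
/-- **`A₂ ∈ V`**: `A₂` vanishes with multiplicity `≥ 2` at the eight base points
`p₁, …, p₈` (two of its linear factors vanish at each of them; `ω² + ω + 1 = 0`).
[cite: ArtebaniDolgachev2009, §6, Prop. 6.1 (proof: "It is easy to see that `V` is spanned by"
`A₁, …, A₄`)] -/
theorem A₂_double_points {ω : K} (hω : ω ^ 2 + ω + 1 = 0) :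
    ∀ q ∈ [![(0 : K), 1, -ω], ![(0 : K), 1, -ω ^ 2], ![(1 : K), 0, -1], ![(1 : K), 0, -ω ^ 2],
      ![(1 : K), 0, -ω], ![(1 : K), -1, 0], ![(1 : K), -ω, 0], ![(1 : K), -ω ^ 2, 0]],
      eval q (𝐀₂[ω] : MvPolynomial (Fin 3) K) = 0 ∧
        (fun i => eval q (pderiv i (𝐀₂[ω] : MvPolynomial (Fin 3) K))) = 0 := by
  intro q hq
  simp only [List.mem_cons, List.not_mem_nil, or_false] at hq
  rcases hq with rfl | rfl | rfl | rfl | rfl | rfl | rfl | rfl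
  · have e : (𝐀₂[ω] : MvPolynomial (Fin 3) K) =
        (X 0 + C (ω ^ 2) * X 1 + C ω * X 2) * (X 0 + C ω * X 1 + X 2) * (X 1 * X 2 * (X 0 + C ω *
          X 1 + C (ω ^ 2) * X 2) * (X 0 + X 1 + C ω * X 2)) := by ac_rfl
    rw [e]
    exact double_point_of_two_factors _ (by
        simp only [map_add, map_mul, eval_X, eval_C, Matrix.cons_val_zero, Matrix.cons_val_one,
          Matrix.cons_val_two, Matrix.head_cons, Matrix.tail_cons]
        ring) (by
        simp only [map_add, map_mul, eval_X, eval_C, Matrix.cons_val_zero, Matrix.cons_val_one,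
          Matrix.cons_val_two, Matrix.head_cons, Matrix.tail_cons]
        ring)
  · have e : (𝐀₂[ω] : MvPolynomial (Fin 3) K) =
        (X 0 + C ω * X 1 + C (ω ^ 2) * X 2) * (X 0 + X 1 + C ω * X 2) * (X 1 * X 2 * (X 0 + C (ω ^
          2) * X 1 + C ω * X 2) * (X 0 + C ω * X 1 + X 2)) := by ac_rfl
    rw [e]
    exact double_point_of_two_factors _ (by
        simp only [map_add, map_mul, eval_X, eval_C, Matrix.cons_val_zero, Matrix.cons_val_one,
          Matrix.cons_val_two, Matrix.head_cons, Matrix.tail_cons]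
        linear_combination (-(ω ^ 2) + ω) * hω) (by
        simp only [map_add, map_mul, eval_X, eval_C, Matrix.cons_val_zero, Matrix.cons_val_one,
          Matrix.cons_val_two, Matrix.head_cons, Matrix.tail_cons]
        linear_combination (-(ω) + 1) * hω)
  · have e : (𝐀₂[ω] : MvPolynomial (Fin 3) K) =
        X 1 * (X 0 + C ω * X 1 + X 2) * (X 2 * (X 0 + C ω * X 1 + C (ω ^ 2) * X 2) * (X 0 + C (ω ^
          2) * X 1 + C ω * X 2) * (X 0 + X
          1 + C ω * X 2)) := by ac_rfl
    rw [e]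
    exact double_point_of_two_factors _ (by
        simp only [eval_X, Matrix.cons_val_zero, Matrix.cons_val_one]) (by
        simp only [map_add, map_mul, eval_X, eval_C, Matrix.cons_val_zero, Matrix.cons_val_one,
          Matrix.cons_val_two, Matrix.head_cons, Matrix.tail_cons]
        ring)
  · have e : (𝐀₂[ω] : MvPolynomial (Fin 3) K) =
        X 1 * (X 0 + C (ω ^ 2) * X 1 + C ω * X 2) * (X 2 * (X 0 + C ω * X 1 + C (ω ^ 2) * X 2) *
          (X 0 + X 1 + C ω * X 2) * (X 0 + C ω * X 1 + X
          2)) := by ac_rfl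
    rw [e]
    exact double_point_of_two_factors _ (by
        simp only [eval_X, Matrix.cons_val_zero, Matrix.cons_val_one]) (by
        simp only [map_add, map_mul, eval_X, eval_C, Matrix.cons_val_zero, Matrix.cons_val_one,
          Matrix.cons_val_two, Matrix.head_cons, Matrix.tail_cons]
        linear_combination (-(ω) + 1) * hω)
  · have e : (𝐀₂[ω] : MvPolynomial (Fin 3) K) =
        X 1 * (X 0 + C ω * X 1 + C (ω ^ 2) * X 2) * (X 2 * (X 0 + C (ω ^ 2) * X 1 + C ω * X 2) *
          (X 0 + X 1 + C ω * X 2) * (X 0 + C ω * X 1 + X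
          2)) := by ac_rfl
    rw [e]
    exact double_point_of_two_factors _ (by
        simp only [eval_X, Matrix.cons_val_zero, Matrix.cons_val_one]) (by
        simp only [map_add, map_mul, eval_X, eval_C, Matrix.cons_val_zero, Matrix.cons_val_one,
          Matrix.cons_val_two, Matrix.head_cons, Matrix.tail_cons]
        linear_combination (-(ω) + 1) * hω)
  · have e : (𝐀₂[ω] : MvPolynomial (Fin 3) K) =
        X 2 * (X 0 + X 1 + C ω * X 2) * (X 1 * (X 0 + C ω * X 1 + C (ω ^ 2) * X 2) * (X 0 + C (ω ^
          2) * X 1 + C ω * X 2) * (X 0 + C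
          ω * X 1 + X 2)) := by ac_rfl
    rw [e]
    exact double_point_of_two_factors _ (by
        simp only [eval_X, Matrix.cons_val_two, Matrix.head_cons, Matrix.tail_cons]) (by
        simp only [map_add, map_mul, eval_X, eval_C, Matrix.cons_val_zero, Matrix.cons_val_one,
          Matrix.cons_val_two, Matrix.head_cons, Matrix.tail_cons]
        ring)
  · have e : (𝐀₂[ω] : MvPolynomial (Fin 3) K) =
        X 2 * (X 0 + C (ω ^ 2) * X 1 + C ω * X 2) * (X 1 * (X 0 + C ω * X 1 + C (ω ^ 2) * X 2) *
          (X 0 + X 1 + C ω * X 2) * (X 0 + C ω * X 1 + X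
          2)) := by ac_rfl
    rw [e]
    exact double_point_of_two_factors _ (by
        simp only [eval_X, Matrix.cons_val_two, Matrix.head_cons, Matrix.tail_cons]) (by
        simp only [map_add, map_mul, eval_X, eval_C, Matrix.cons_val_zero, Matrix.cons_val_one,
          Matrix.cons_val_two, Matrix.head_cons, Matrix.tail_cons]
        linear_combination (-(ω) + 1) * hω)
  · have e : (𝐀₂[ω] : MvPolynomial (Fin 3) K) =
        X 2 * (X 0 + C ω * X 1 + C (ω ^ 2) * X 2) * (X 1 * (X 0 + C (ω ^ 2) * X 1 + C ω * X 2) *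
          (X 0 + X 1 + C ω * X 2) * (X 0 + C ω * X 1 + X
          2)) := by ac_rfl
    rw [e]
    exact double_point_of_two_factors _ (by
        simp only [eval_X, Matrix.cons_val_two, Matrix.head_cons, Matrix.tail_cons]) (by
        simp only [map_add, map_mul, eval_X, eval_C, Matrix.cons_val_zero, Matrix.cons_val_one,
          Matrix.cons_val_two, Matrix.head_cons, Matrix.tail_cons]
        linear_combination (-(ω) + 1) * hω)

set_option maxHeartbeats 800000 in
/-- **`A₃ ∈ V`**: `A₃` vanishes with multiplicity `≥ 2` at the eight base points
`p₁, …, p₈` (two of its linear factors vanish at each of them; `ω² + ω + 1 = 0`).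
[cite: ArtebaniDolgachev2009, §6, Prop. 6.1 (proof: "It is easy to see that `V` is spanned by"
`A₁, …, A₄`)] -/
theorem A₃_double_points {ω : K} (hω : ω ^ 2 + ω + 1 = 0) :
    ∀ q ∈ [![(0 : K), 1, -ω], ![(0 : K), 1, -ω ^ 2], ![(1 : K), 0, -1], ![(1 : K), 0, -ω ^ 2],
      ![(1 : K), 0, -ω], ![(1 : K), -1, 0], ![(1 : K), -ω, 0], ![(1 : K), -ω ^ 2, 0]],
      eval q (𝐀₃[ω] : MvPolynomial (Fin 3) K) = 0 ∧
        (fun i => eval q (pderiv i (𝐀₃[ω] : MvPolynomial (Fin 3) K))) = 0 := by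
  intro q hq
  simp only [List.mem_cons, List.not_mem_nil, or_false] at hq
  rcases hq with rfl | rfl | rfl | rfl | rfl | rfl | rfl | rfl
  · have e : (𝐀₃[ω] : MvPolynomial (Fin 3) K) =
        (X 0 + X 1 + C (ω ^ 2) * X 2) * (X 0 + C (ω ^ 2) * X 1 + C ω * X 2) * (X 1 * X 2 * (X 0 +
          C (ω ^ 2) * X 1 + X 2) * (X 0 + C ω * X 1 + C (ω ^ 2) * X 2)) := by ac_rfl
    rw [e]
    exact double_point_of_two_factors _ (by
        simp only [map_add, map_mul, eval_X, eval_C, Matrix.cons_val_zero, Matrix.cons_val_one,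
          Matrix.cons_val_two, Matrix.head_cons, Matrix.tail_cons]
        linear_combination (-(ω) + 1) * hω) (by
        simp only [map_add, map_mul, eval_X, eval_C, Matrix.cons_val_zero, Matrix.cons_val_one,
          Matrix.cons_val_two, Matrix.head_cons, Matrix.tail_cons]
        ring)
  · have e : (𝐀₃[ω] : MvPolynomial (Fin 3) K) =
        (X 0 + C (ω ^ 2) * X 1 + X 2) * (X 0 + C ω * X 1 + C (ω ^ 2) * X 2) * (X 1 * X 2 * (X 0 +
          X 1 + C (ω ^ 2) * X 2) * (X 0 + C (ω ^ 2) * X 1 + C ω * X 2)) := by ac_rfl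
    rw [e]
    exact double_point_of_two_factors _ (by
        simp only [map_add, map_mul, eval_X, eval_C, Matrix.cons_val_zero, Matrix.cons_val_one,
          Matrix.cons_val_two, Matrix.head_cons, Matrix.tail_cons]
        ring) (by
        simp only [map_add, map_mul, eval_X, eval_C, Matrix.cons_val_zero, Matrix.cons_val_one,
          Matrix.cons_val_two, Matrix.head_cons, Matrix.tail_cons]
        linear_combination (-(ω ^ 2) + ω) * hω)
  · have e : (𝐀₃[ω] : MvPolynomial (Fin 3) K) =
        X 1 * (X 0 + C (ω ^ 2) * X 1 + X 2) * (X 2 * (X 0 + X 1 + C (ω ^ 2) * X 2) * (X 0 + C ω *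
          X 1 + C (ω ^ 2) * X 2) * (X 0 + C (ω ^
          2) * X 1 + C ω * X 2)) := by ac_rfl
    rw [e]
    exact double_point_of_two_factors _ (by
        simp only [eval_X, Matrix.cons_val_zero, Matrix.cons_val_one]) (by
        simp only [map_add, map_mul, eval_X, eval_C, Matrix.cons_val_zero, Matrix.cons_val_one,
          Matrix.cons_val_two, Matrix.head_cons, Matrix.tail_cons]
        ring)
  · have e : (𝐀₃[ω] : MvPolynomial (Fin 3) K) =
        X 1 * (X 0 + C (ω ^ 2) * X 1 + C ω * X 2) * (X 2 * (X 0 + C (ω ^ 2) * X 1 + X 2) * (X 0 +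
          X 1 + C (ω ^ 2) * X 2) * (X 0 + C ω * X 1 + C
          (ω ^ 2) * X 2)) := by ac_rfl
    rw [e]
    exact double_point_of_two_factors _ (by
        simp only [eval_X, Matrix.cons_val_zero, Matrix.cons_val_one]) (by
        simp only [map_add, map_mul, eval_X, eval_C, Matrix.cons_val_zero, Matrix.cons_val_one,
          Matrix.cons_val_two, Matrix.head_cons, Matrix.tail_cons]
        linear_combination (-(ω) + 1) * hω)
  · have e : (𝐀₃[ω] : MvPolynomial (Fin 3) K) =
        X 1 * (X 0 + X 1 + C (ω ^ 2) * X 2) * (X 2 * (X 0 + C (ω ^ 2) * X 1 + X 2) * (X 0 + C ω *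
          X 1 + C (ω ^ 2) * X 2) * (X 0 + C (ω ^
          2) * X 1 + C ω * X 2)) := by ac_rfl
    rw [e]
    exact double_point_of_two_factors _ (by
        simp only [eval_X, Matrix.cons_val_zero, Matrix.cons_val_one]) (by
        simp only [map_add, map_mul, eval_X, eval_C, Matrix.cons_val_zero, Matrix.cons_val_one,
          Matrix.cons_val_two, Matrix.head_cons, Matrix.tail_cons]
        linear_combination (-(ω) + 1) * hω)
  · have e : (𝐀₃[ω] : MvPolynomial (Fin 3) K) =
        X 2 * (X 0 + X 1 + C (ω ^ 2) * X 2) * (X 1 * (X 0 + C (ω ^ 2) * X 1 + X 2) * (X 0 + C ω *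
          X 1 + C (ω ^ 2) * X 2) * (X 0 + C (ω ^
          2) * X 1 + C ω * X 2)) := by ac_rfl
    rw [e]
    exact double_point_of_two_factors _ (by
        simp only [eval_X, Matrix.cons_val_two, Matrix.head_cons, Matrix.tail_cons]) (by
        simp only [map_add, map_mul, eval_X, eval_C, Matrix.cons_val_zero, Matrix.cons_val_one,
          Matrix.cons_val_two, Matrix.head_cons, Matrix.tail_cons]
        ring)
  · have e : (𝐀₃[ω] : MvPolynomial (Fin 3) K) =
        X 2 * (X 0 + C (ω ^ 2) * X 1 + X 2) * (X 1 * (X 0 + X 1 + C (ω ^ 2) * X 2) * (X 0 + C ω *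
          X 1 + C (ω ^ 2) * X 2) * (X 0 + C (ω ^
          2) * X 1 + C ω * X 2)) := by ac_rfl
    rw [e]
    exact double_point_of_two_factors _ (by
        simp only [eval_X, Matrix.cons_val_two, Matrix.head_cons, Matrix.tail_cons]) (by
        simp only [map_add, map_mul, eval_X, eval_C, Matrix.cons_val_zero, Matrix.cons_val_one,
          Matrix.cons_val_two, Matrix.head_cons, Matrix.tail_cons]
        linear_combination (-(ω) + 1) * hω)
  · have e : (𝐀₃[ω] : MvPolynomial (Fin 3) K) =
        X 2 * (X 0 + C ω * X 1 + C (ω ^ 2) * X 2) * (X 1 * (X 0 + C (ω ^ 2) * X 1 + X 2) * (X 0 +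
          X 1 + C (ω ^ 2) * X 2) * (X 0 + C (ω ^ 2) * X
          1 + C ω * X 2)) := by ac_rfl
    rw [e]
    exact double_point_of_two_factors _ (by
        simp only [eval_X, Matrix.cons_val_two, Matrix.head_cons, Matrix.tail_cons]) (by
        simp only [map_add, map_mul, eval_X, eval_C, Matrix.cons_val_zero, Matrix.cons_val_one,
          Matrix.cons_val_two, Matrix.head_cons, Matrix.tail_cons]
        linear_combination (-(ω) + 1) * hω)

set_option maxHeartbeats 800000 in
/-- **`A₄ ∈ V`**: `A₄` vanishes with multiplicity `≥ 2` at the eight base points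
`p₁, …, p₈` (two of its linear factors vanish at each of them; `ω² + ω + 1 = 0`).
[cite: ArtebaniDolgachev2009, §6, Prop. 6.1 (proof: "It is easy to see that `V` is spanned by"
`A₁, …, A₄`)] -/
theorem A₄_double_points {ω : K} (hω : ω ^ 2 + ω + 1 = 0) :
    ∀ q ∈ [![(0 : K), 1, -ω], ![(0 : K), 1, -ω ^ 2], ![(1 : K), 0, -1], ![(1 : K), 0, -ω ^ 2],
      ![(1 : K), 0, -ω], ![(1 : K), -1, 0], ![(1 : K), -ω, 0], ![(1 : K), -ω ^ 2, 0]],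
      eval q (𝐀₄[ω] : MvPolynomial (Fin 3) K) = 0 ∧
        (fun i => eval q (pderiv i (𝐀₄[ω] : MvPolynomial (Fin 3) K))) = 0 := by
  intro q hq
  simp only [List.mem_cons, List.not_mem_nil, or_false] at hq
  rcases hq with rfl | rfl | rfl | rfl | rfl | rfl | rfl | rfl
  · have e : (𝐀₄[ω] : MvPolynomial (Fin 3) K) =
        (X 0 + C (ω ^ 2) * X 1 + C ω * X 2) * (X 0 + C ω * X 1 + X 2) * ((X 0 + C ω * X 1 + C (ω ^
          2) * X 2) * (X 0 + X 1 + C ω * X 2) * (X 0 + C (ω ^ 2) * X 1 + X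
          2) * (X 0 + X 1 + C (ω ^ 2) * X 2)) := by ac_rfl
    rw [e]
    exact double_point_of_two_factors _ (by
        simp only [map_add, map_mul, eval_X, eval_C, Matrix.cons_val_zero, Matrix.cons_val_one,
          Matrix.cons_val_two, Matrix.head_cons, Matrix.tail_cons]
        ring) (by
        simp only [map_add, map_mul, eval_X, eval_C, Matrix.cons_val_zero, Matrix.cons_val_one,
          Matrix.cons_val_two, Matrix.head_cons, Matrix.tail_cons]
        ring)
  · have e : (𝐀₄[ω] : MvPolynomial (Fin 3) K) =
        (X 0 + C ω * X 1 + C (ω ^ 2) * X 2) * (X 0 + X 1 + C ω * X 2) * ((X 0 + C (ω ^ 2) * X 1 +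
          C ω * X 2) * (X 0 + C ω * X 1 + X 2) * (X 0 + C (ω ^ 2) * X 1 + X
          2) * (X 0 + X 1 + C (ω ^ 2) * X 2)) := by ac_rfl
    rw [e]
    exact double_point_of_two_factors _ (by
        simp only [map_add, map_mul, eval_X, eval_C, Matrix.cons_val_zero, Matrix.cons_val_one,
          Matrix.cons_val_two, Matrix.head_cons, Matrix.tail_cons]
        linear_combination (-(ω ^ 2) + ω) * hω) (by
        simp only [map_add, map_mul, eval_X, eval_C, Matrix.cons_val_zero, Matrix.cons_val_one,
          Matrix.cons_val_two, Matrix.head_cons, Matrix.tail_cons]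
        linear_combination (-(ω) + 1) * hω)
  · have e : (𝐀₄[ω] : MvPolynomial (Fin 3) K) =
        (X 0 + C ω * X 1 + X 2) * (X 0 + C (ω ^ 2) * X 1 + X 2) * ((X 0 + C ω * X 1 + C (ω ^ 2) *
          X 2) * (X 0 + C (ω ^ 2) * X 1 + C ω * X 2) * (X 0 + X 1 + C
          ω * X 2) * (X 0 + X 1 + C (ω ^ 2) * X 2)) := by ac_rfl
    rw [e]
    exact double_point_of_two_factors _ (by
        simp only [map_add, map_mul, eval_X, eval_C, Matrix.cons_val_zero, Matrix.cons_val_one,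
          Matrix.cons_val_two, Matrix.head_cons, Matrix.tail_cons]
        ring) (by
        simp only [map_add, map_mul, eval_X, eval_C, Matrix.cons_val_zero, Matrix.cons_val_one,
          Matrix.cons_val_two, Matrix.head_cons, Matrix.tail_cons]
        ring)
  · have e : (𝐀₄[ω] : MvPolynomial (Fin 3) K) =
        (X 0 + C (ω ^ 2) * X 1 + C ω * X 2) * (X 0 + X 1 + C ω * X 2) * ((X 0 + C ω * X 1 + C (ω ^
          2) * X 2) * (X 0 + C ω * X 1 + X 2) * (X 0 + C (ω ^ 2) * X 1 + X
          2) * (X 0 + X 1 + C (ω ^ 2) * X 2)) := by ac_rfl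
    rw [e]
    exact double_point_of_two_factors _ (by
        simp only [map_add, map_mul, eval_X, eval_C, Matrix.cons_val_zero, Matrix.cons_val_one,
          Matrix.cons_val_two, Matrix.head_cons, Matrix.tail_cons]
        linear_combination (-(ω) + 1) * hω) (by
        simp only [map_add, map_mul, eval_X, eval_C, Matrix.cons_val_zero, Matrix.cons_val_one,
          Matrix.cons_val_two, Matrix.head_cons, Matrix.tail_cons]
        linear_combination (-(ω) + 1) * hω)
  · have e : (𝐀₄[ω] : MvPolynomial (Fin 3) K) =
        (X 0 + C ω * X 1 + C (ω ^ 2) * X 2) * (X 0 + X 1 + C (ω ^ 2) * X 2) * ((X 0 + C (ω ^ 2) *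
          X 1 + C ω * X 2) * (X 0 + X 1 + C ω * X 2) * (X 0 + C ω * X 1 + X 2) *
          (X 0 + C (ω ^ 2) * X 1 + X 2)) := by ac_rfl
    rw [e]
    exact double_point_of_two_factors _ (by
        simp only [map_add, map_mul, eval_X, eval_C, Matrix.cons_val_zero, Matrix.cons_val_one,
          Matrix.cons_val_two, Matrix.head_cons, Matrix.tail_cons]
        linear_combination (-(ω) + 1) * hω) (by
        simp only [map_add, map_mul, eval_X, eval_C, Matrix.cons_val_zero, Matrix.cons_val_one,
          Matrix.cons_val_two, Matrix.head_cons, Matrix.tail_cons]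
        linear_combination (-(ω) + 1) * hω)
  · have e : (𝐀₄[ω] : MvPolynomial (Fin 3) K) =
        (X 0 + X 1 + C ω * X 2) * (X 0 + X 1 + C (ω ^ 2) * X 2) * ((X 0 + C ω * X 1 + C (ω ^ 2) *
          X 2) * (X 0 + C (ω ^ 2) * X 1 + C ω * X 2) * (X 0 + C ω * X
          1 + X 2) * (X 0 + C (ω ^ 2) * X 1 + X 2)) := by ac_rfl
    rw [e]
    exact double_point_of_two_factors _ (by
        simp only [map_add, map_mul, eval_X, eval_C, Matrix.cons_val_zero, Matrix.cons_val_one,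
          Matrix.cons_val_two, Matrix.head_cons, Matrix.tail_cons]
        ring) (by
        simp only [map_add, map_mul, eval_X, eval_C, Matrix.cons_val_zero, Matrix.cons_val_one,
          Matrix.cons_val_two, Matrix.head_cons, Matrix.tail_cons]
        ring)
  · have e : (𝐀₄[ω] : MvPolynomial (Fin 3) K) =
        (X 0 + C (ω ^ 2) * X 1 + C ω * X 2) * (X 0 + C (ω ^ 2) * X 1 + X 2) * ((X 0 + C ω * X 1 +
          C (ω ^ 2) * X 2) * (X 0 + X 1 + C ω * X 2) * (X 0 + C ω * X 1 + X 2) *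
          (X 0 + X 1 + C (ω ^ 2) * X 2)) := by ac_rfl
    rw [e]
    exact double_point_of_two_factors _ (by
        simp only [map_add, map_mul, eval_X, eval_C, Matrix.cons_val_zero, Matrix.cons_val_one,
          Matrix.cons_val_two, Matrix.head_cons, Matrix.tail_cons]
        linear_combination (-(ω) + 1) * hω) (by
        simp only [map_add, map_mul, eval_X, eval_C, Matrix.cons_val_zero, Matrix.cons_val_one,
          Matrix.cons_val_two, Matrix.head_cons, Matrix.tail_cons]
        linear_combination (-(ω) + 1) * hω)
  · have e : (𝐀₄[ω] : MvPolynomial (Fin 3) K) =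
        (X 0 + C ω * X 1 + C (ω ^ 2) * X 2) * (X 0 + C ω * X 1 + X 2) * ((X 0 + C (ω ^ 2) * X 1 +
          C ω * X 2) * (X 0 + X 1 + C ω * X 2) * (X 0 + C (ω ^ 2) * X 1 + X
          2) * (X 0 + X 1 + C (ω ^ 2) * X 2)) := by ac_rfl
    rw [e]
    exact double_point_of_two_factors _ (by
        simp only [map_add, map_mul, eval_X, eval_C, Matrix.cons_val_zero, Matrix.cons_val_one,
          Matrix.cons_val_two, Matrix.head_cons, Matrix.tail_cons]
        linear_combination (-(ω) + 1) * hω) (by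
        simp only [map_add, map_mul, eval_X, eval_C, Matrix.cons_val_zero, Matrix.cons_val_one,
          Matrix.cons_val_two, Matrix.head_cons, Matrix.tail_cons]
        linear_combination (-(ω) + 1) * hω)

/-! ## §2 "Applying `g₄` we find that `(A₁, A₂, A₃, A₄) ↦ (ε²A₂, ε²A₃, ε²A₁, A₄)`" -/

/-- **"Applying `g₄` we find that `(A₁, A₂, A₃, A₄) ↦ (ε²A₂, ε²A₃, ε²A₁, A₄)`"**, the
`A₁`-component: `A₁ ∘ g₄ = ε²A₂` (`g₄ = diag(1, ε, ε)`, `F ∘ g₄ = F(x, εy, εz)`; each linear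
factor of `A₁` goes to `ε^k` times a linear factor of `A₂`, `ω³ = 1`).
[cite: ArtebaniDolgachev2009, §6, Prop. 6.1 (proof)] -/
theorem A₁_bind₁_g₄ {ω : K} (hω : ω ^ 2 + ω + 1 = 0) :
    bind₁ (Matrix.of ![![(1 : K), 0, 0], ![0, ω, 0], ![0, 0, ω]] :
        Matrix (Fin 3) (Fin 3) K).toMvPolynomial (𝐀₁[ω] : MvPolynomial (Fin 3) K) =
      (ω ^ 2) • 𝐀₂[ω] := by
  obtain ⟨h11, h21, h12, h22⟩ := C_omega_scalars hω
  simp only [map_add, map_mul, bind₁_X_right, bind₁_C_right, toMvPolynomial_fin_three_c,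
    Matrix.of_apply, Matrix.cons_val_zero, Matrix.cons_val_one, Matrix.cons_val_two,
    Matrix.head_cons, Matrix.tail_cons, map_one, map_zero, one_mul, zero_mul, add_zero, zero_add,
    h11, h21, smul_eq_C_mul]
  simp only [map_pow]
  ring

/-- **"Applying `g₄` we find that `(A₁, A₂, A₃, A₄) ↦ (ε²A₂, ε²A₃, ε²A₁, A₄)`"**, the
`A₂`-component: `A₂ ∘ g₄ = ε²A₃` (`g₄ = diag(1, ε, ε)`, `F ∘ g₄ = F(x, εy, εz)`; each linear
factor of `A₂` goes to `ε^k` times a linear factor of `A₃`, `ω³ = 1`).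
[cite: ArtebaniDolgachev2009, §6, Prop. 6.1 (proof)] -/
theorem A₂_bind₁_g₄ {ω : K} (hω : ω ^ 2 + ω + 1 = 0) :
    bind₁ (Matrix.of ![![(1 : K), 0, 0], ![0, ω, 0], ![0, 0, ω]] :
        Matrix (Fin 3) (Fin 3) K).toMvPolynomial (𝐀₂[ω] : MvPolynomial (Fin 3) K) =
      (ω ^ 2) • 𝐀₃[ω] := by
  obtain ⟨h11, h21, h12, h22⟩ := C_omega_scalars hω
  simp only [map_add, map_mul, bind₁_X_right, bind₁_C_right, toMvPolynomial_fin_three_c,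
    Matrix.of_apply, Matrix.cons_val_zero, Matrix.cons_val_one, Matrix.cons_val_two,
    Matrix.head_cons, Matrix.tail_cons, map_one, map_zero, one_mul, zero_mul, add_zero, zero_add,
    h11, h21, smul_eq_C_mul]
  simp only [map_pow]
  ring

/-- **"Applying `g₄` we find that `(A₁, A₂, A₃, A₄) ↦ (ε²A₂, ε²A₃, ε²A₁, A₄)`"**, the
`A₃`-component: `A₃ ∘ g₄ = ε²A₁` (`g₄ = diag(1, ε, ε)`, `F ∘ g₄ = F(x, εy, εz)`; each linear
factor of `A₃` goes to `ε^k` times a linear factor of `A₁`, `ω³ = 1`).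
[cite: ArtebaniDolgachev2009, §6, Prop. 6.1 (proof)] -/
theorem A₃_bind₁_g₄ {ω : K} (hω : ω ^ 2 + ω + 1 = 0) :
    bind₁ (Matrix.of ![![(1 : K), 0, 0], ![0, ω, 0], ![0, 0, ω]] :
        Matrix (Fin 3) (Fin 3) K).toMvPolynomial (𝐀₃[ω] : MvPolynomial (Fin 3) K) =
      (ω ^ 2) • 𝐀₁[ω] := by
  obtain ⟨h11, h21, h12, h22⟩ := C_omega_scalars hω
  simp only [map_add, map_mul, bind₁_X_right, bind₁_C_right, toMvPolynomial_fin_three_c,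
    Matrix.of_apply, Matrix.cons_val_zero, Matrix.cons_val_one, Matrix.cons_val_two,
    Matrix.head_cons, Matrix.tail_cons, map_one, map_zero, one_mul, zero_mul, add_zero, zero_add,
    h11, h21, smul_eq_C_mul]
  simp only [map_pow]
  ring

/-- **"Applying `g₄` we find that `(A₁, A₂, A₃, A₄) ↦ (ε²A₂, ε²A₃, ε²A₁, A₄)`"**, the
`A₄`-component: `A₄ ∘ g₄ = A₄` (`g₄ = diag(1, ε, ε)`, `F ∘ g₄ = F(x, εy, εz)`; each linear
factor of `A₄` goes to `ε^k` times a linear factor of `A₄`, `ω³ = 1`).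
[cite: ArtebaniDolgachev2009, §6, Prop. 6.1 (proof)] -/
theorem A₄_bind₁_g₄ {ω : K} (hω : ω ^ 2 + ω + 1 = 0) :
    bind₁ (Matrix.of ![![(1 : K), 0, 0], ![0, ω, 0], ![0, 0, ω]] :
        Matrix (Fin 3) (Fin 3) K).toMvPolynomial (𝐀₄[ω] : MvPolynomial (Fin 3) K) =
      (𝐀₄[ω] : MvPolynomial (Fin 3) K) := by
  obtain ⟨h11, h21, h12, h22⟩ := C_omega_scalars hω
  simp only [map_add, map_mul, bind₁_X_right, bind₁_C_right, toMvPolynomial_fin_three_c,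
    Matrix.of_apply, Matrix.cons_val_zero, Matrix.cons_val_one, Matrix.cons_val_two,
    Matrix.head_cons, Matrix.tail_cons, map_one, map_zero, one_mul, zero_mul, add_zero, zero_add,
    h11, h21]
  ring

/-! ## §3 "`P = λ(A₁ + ε²A₂ + εA₃) + μA₄`": `Φ₆′ = A₄ − 3(A₁ + ε²A₂ + εA₃)` -/

set_option maxHeartbeats 800000 in
/-- **"Thus `P(x, y, z) = λ(A₁ + ε²A₂ + εA₃) + μA₄` for some constants `λ, μ`"**, with the
constants PINNED: `Φ₆′ = A₄ − 3(A₁ + ε²A₂ + εA₃)`, i.e. `(λ, μ) = (−3, 1)` (`ω² + ω + 1 = 0`).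
Proof: the six linear factors pair up into `ε`-free quadratics —
`(x + εy + ε²z)(x + ε²y + εz) = x² + y² + z² − xy − xz − yz`,
`(x + εy + z)(x + ε²y + z) = (x + z)² − (x + z)y + y²`, `(x + y + εz)(x + y + ε²z) = (x + y)² − (x
  + y)z + z²`
— so that `A₄` and `A₁` are `ε`-free and `ε²A₂ + εA₃ = yz·(x² + y² + z² − xy − xz − yz)·(−x² + x(y
  + z) +
2(y² − yz + z²))`; what is left is an identity of integer sextics.
[cite: ArtebaniDolgachev2009, §6, Prop. 6.1 (proof)] -/
theorem phi6'_eq_A_combination {ω : K} (hω : ω ^ 2 + ω + 1 = 0) :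
    (Φ₆' : MvPolynomial (Fin 3) K) = 𝐀₄[ω] - 3 * (𝐀₁[ω] + C (ω ^ 2) * 𝐀₂[ω] + C ω * 𝐀₃[ω]) := by
  obtain ⟨-, hCrel⟩ := C_omega_facts hω
  have hQ₀ : (X 0 + C ω * X 1 + C (ω ^ 2) * X 2 : MvPolynomial (Fin 3) K) * (X 0 + C (ω ^ 2) * X 1
    + C ω * X 2) =
      (X 0 ^ 2 + X 1 ^ 2 + X 2 ^ 2 - X 0 * X 1 - X 0 * X 2 - X 1 * X 2) := by
    simp only [map_pow]
    linear_combination (X 0 * X 1 + X 0 * X 2 + X 1 ^ 2 * C ω - (X 1 ^ 2) + X 1 * X 2 * C ω ^ 2 - (X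
    1 * X 2 * C ω) + X 1 * X 2 + X 2 ^ 2 * C ω - (X 2 ^ 2) : MvPolynomial (Fin 3) K) * hCrel
  have hP₁ : (X 0 + C ω * X 1 + X 2 : MvPolynomial (Fin 3) K) * (X 0 + C (ω ^ 2) * X 1 + X 2) =
      ((X 0 + X 2) ^ 2 - (X 0 + X 2) * X 1 + X 1 ^ 2) := by
    simp only [map_pow]
    linear_combination (X 0 * X 1 + X 1 ^ 2 * C ω - (X 1 ^ 2) + X 1 * X 2 : MvPolynomial (Fin 3) K)
    * hCrel
  have hP₂ : (X 0 + X 1 + C ω * X 2 : MvPolynomial (Fin 3) K) * (X 0 + X 1 + C (ω ^ 2) * X 2) =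
      ((X 0 + X 1) ^ 2 - (X 0 + X 1) * X 2 + X 2 ^ 2) := by
    simp only [map_pow]
    linear_combination (X 0 * X 2 + X 1 * X 2 + X 2 ^ 2 * C ω - (X 2 ^ 2) : MvPolynomial (Fin 3) K)
    * hCrel
  have hM : (X 0 + X 1 + C ω * X 2 : MvPolynomial (Fin 3) K) * (X 0 + C ω * X 1 + X 2) =
      (X 0 ^ 2 - C ω ^ 2 * (X 0 * X 1) - C ω ^ 2 * (X 0 * X 2) + C ω * X 1 ^ 2 - C ω * (X 1 * X 2) +
        C ω * X 2 ^ 2) := by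
    linear_combination (X 0 * X 1 + X 0 * X 2 + X 1 * X 2 : MvPolynomial (Fin 3) K) * hCrel
  have hM' : (X 0 + C (ω ^ 2) * X 1 + X 2 : MvPolynomial (Fin 3) K) * (X 0 + X 1 + C (ω ^ 2) * X
    2) =
      (X 0 ^ 2 - C ω * (X 0 * X 1) - C ω * (X 0 * X 2) + C ω ^ 2 * X 1 ^ 2 - C ω ^ 2 * (X 1 * X 2) +
        C ω ^ 2 * X 2 ^ 2) := by
    simp only [map_pow]
    linear_combination (X 0 * X 1 + X 0 * X 2 + X 1 * X 2 * C ω ^ 2 - (X 1 * X 2 * C ω) + X 1 * X 2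
    : MvPolynomial (Fin 3) K) * hCrel
  have e₄ : (𝐀₄[ω] : MvPolynomial (Fin 3) K) =
      (X 0 + C ω * X 1 + C (ω ^ 2) * X 2) * (X 0 + C (ω ^ 2) * X 1 + C ω * X 2) * (((X 0 + C ω * X
        1 + X 2) * (X 0 + C (ω ^ 2) * X 1 + X 2)) *
        ((X 0 + X 1 + C ω * X 2) * (X 0 + X 1 + C (ω ^ 2) * X 2))) := by ac_rfl
  have e₁ : (𝐀₁[ω] : MvPolynomial (Fin 3) K) =
      X 1 * X 2 * (((X 0 + C ω * X 1 + X 2) * (X 0 + C (ω ^ 2) * X 1 + X 2)) * ((X 0 + X 1 + C ω *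
        X 2) * (X 0 + X 1 + C (ω ^ 2) * X 2))) := by ac_rfl
  have e₂ : (𝐀₂[ω] : MvPolynomial (Fin 3) K) =
      X 1 * X 2 * (((X 0 + C ω * X 1 + C (ω ^ 2) * X 2) * (X 0 + C (ω ^ 2) * X 1 + C ω * X 2)) *
        ((X 0 + X 1 + C ω * X 2) * (X 0 + C ω * X 1 + X 2))) := by ac_rfl
  have e₃ : (𝐀₃[ω] : MvPolynomial (Fin 3) K) =
      X 1 * X 2 * (((X 0 + C ω * X 1 + C (ω ^ 2) * X 2) * (X 0 + C (ω ^ 2) * X 1 + C ω * X 2)) *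
        ((X 0 + C (ω ^ 2) * X 1 + X 2) * (X 0 + X 1 + C (ω ^ 2) * X 2))) := by ac_rfl
  rw [e₄, e₁, e₂, e₃, hQ₀, hP₁, hP₂, hM, hM']
  simp only [map_pow]
  linear_combination (3 * X 0 ^ 4 * X 1 * X 2 - 3 * X 0 ^ 3 * X 1 ^ 2 * X 2 * C ω ^ 2 + 3 * X 0 ^ 3
  * X 1 ^ 2 * X 2 * C ω - 6 * X 0 ^ 3 * X 1 ^ 2 * X 2 - 3 * X 0 ^ 3 * X 1 * X 2 ^ 2 * C ω ^ 2 + 3 *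
  X 0 ^ 3 * X 1 * X 2 ^ 2 * C ω - 6 * X 0 ^ 3 * X 1 * X 2 ^ 2 + 3 * X 0 ^ 2 * X 1 ^ 3 * X 2 * C ω ^
  2 + 3 * X 0 ^ 2 * X 1 ^ 3 * X 2 * C ω + 6 * X 0 ^ 2 * X 1 ^ 2 * X 2 ^ 2 * C ω ^ 2 - 12 * X 0 ^ 2 *
  X 1 ^ 2 * X 2 ^ 2 * C ω + 9 * X 0 ^ 2 * X 1 ^ 2 * X 2 ^ 2 + 3 * X 0 ^ 2 * X 1 * X 2 ^ 3 * C ω ^ 2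
  + 3 * X 0 ^ 2 * X 1 * X 2 ^ 3 * C ω - 3 * X 0 * X 1 ^ 4 * X 2 * C ω ^ 2 - 3 * X 0 * X 1 ^ 4 * X 2
  * C ω + 3 * X 0 * X 1 ^ 4 * X 2 - 3 * X 0 * X 1 * X 2 ^ 4 * C ω ^ 2 - 3 * X 0 * X 1 * X 2 ^ 4 * C
  ω + 3 * X 0 * X 1 * X 2 ^ 4 + 6 * X 1 ^ 5 * X 2 * C ω - 6 * X 1 ^ 5 * X 2 - 12 * X 1 ^ 4 * X 2 ^ 2
  * C ω + 12 * X 1 ^ 4 * X 2 ^ 2 + 18 * X 1 ^ 3 * X 2 ^ 3 * C ω - 18 * X 1 ^ 3 * X 2 ^ 3 - 12 * X 1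
  ^ 2 * X 2 ^ 4 * C ω + 12 * X 1 ^ 2 * X 2 ^ 4 + 6 * X 1 * X 2 ^ 5 * C ω - 6 * X 1 * X 2 ^ 5 :
  MvPolynomial (Fin 3) K) * hCrel

/-! ## §4 The invariance of `Φ₆′` under `g₄` and (up to the `SL(3)`-normalisation) `g₃` -/

set_option maxHeartbeats 2000000 in
/-- **`Φ₆′` is `g₄`-invariant**: `Φ₆′ ∘ g₄ = Φ₆′` (`g₄ = diag(1, ε, ε)`; every monomial of `Φ₆′` has
`y, z`-degree divisible by `3`). [cite: ArtebaniDolgachev2009, §6, Prop. 6.1 (proof: `P` "is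
invariant with respect to the linear representation of the binary tetrahedral group
`T̄ ≅ SL(2, 𝔽₃)`"; "find `λ, μ` such that `P(x, y, z)` is invariant")] -/
theorem phi6'_bind₁_g₄ {ω : K} (hω : ω ^ 2 + ω + 1 = 0) :
    bind₁ (Matrix.of ![![(1 : K), 0, 0], ![0, ω, 0], ![0, 0, ω]] :
        Matrix (Fin 3) (Fin 3) K).toMvPolynomial (Φ₆' : MvPolynomial (Fin 3) K) = Φ₆' := by
  obtain ⟨hC3, -⟩ := C_omega_facts hω
  simp only [map_add, map_sub, map_mul, map_pow, bind₁_X_right, toMvPolynomial_fin_three_c,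
    Matrix.of_apply, Matrix.cons_val_zero, Matrix.cons_val_one, Matrix.cons_val_two,
      Matrix.head_cons,
    Matrix.tail_cons, map_one, map_zero, map_ofNat]
  linear_combination (2 * X 0 ^ 3 * X 1 ^ 3 - 12 * X 0 ^ 3 * X 1 ^ 2 * X 2 - 12 * X 0 ^ 3 * X 1 * X
  2 ^ 2 + 2 * X 0 ^ 3 * X 2 ^ 3 + X 1 ^ 6 * C ω ^ 3 + X 1 ^ 6 - 12 * X 1 ^ 5 * X 2 * C ω ^ 3 - 12 *
  X 1 ^ 5 * X 2 + 24 * X 1 ^ 4 * X 2 ^ 2 * C ω ^ 3 + 24 * X 1 ^ 4 * X 2 ^ 2 - 34 * X 1 ^ 3 * X 2 ^ 3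
  * C ω ^ 3 - 34 * X 1 ^ 3 * X 2 ^ 3 + 24 * X 1 ^ 2 * X 2 ^ 4 * C ω ^ 3 + 24 * X 1 ^ 2 * X 2 ^ 4 -
  12 * X 1 * X 2 ^ 5 * C ω ^ 3 - 12 * X 1 * X 2 ^ 5 + X 2 ^ 6 * C ω ^ 3 + X 2 ^ 6 : MvPolynomial
  (Fin 3) K) * hC3

/-- **`Φ₆′ ∘ g₃ = −27·Φ₆′`** (`g₃ = [[1, 1, 1], [1, ε, ε²], [1, ε², ε]]`, `ω² + ω + 1 = 0`): with
  the
`SL(3)`-normalisation `(ε − ε²)⁻¹g₃` of §4 of the source (`(ε − ε²)⁶ = −27`) this is the invariance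
of `P = Φ₆′` under `g₃` ("Now we apply `g₃` and find `λ, μ` such that `P(x, y, z)` is invariant").
Proof: with `X = x + y + z`, `Y = x + εy + ε²z`, `Z = x + ε²y + εz` one has `Y + Z = 2x − y − z` and
`YZ = x² + y² + z² − xy − xz − yz`, and `Φ₆′(X, Y, Z)` is symmetric in `Y, Z`; what is left is an
identity of integer sextics. [cite: ArtebaniDolgachev2009, §6, Prop. 6.1 (proof)] -/
theorem phi6'_bind₁_g₃ {ω : K} (hω : ω ^ 2 + ω + 1 = 0) :
    bind₁ (Matrix.of ![![(1 : K), 1, 1], ![1, ω, ω ^ 2], ![1, ω ^ 2, ω]] :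
        Matrix (Fin 3) (Fin 3) K).toMvPolynomial (Φ₆' : MvPolynomial (Fin 3) K) = (-27 : K) • Φ₆'
          := by
  obtain ⟨-, hCrel⟩ := C_omega_facts hω
  have hL : (X 0 + C ω * X 1 + C ω ^ 2 * X 2 : MvPolynomial (Fin 3) K) +
      (X 0 + C ω ^ 2 * X 1 + C ω * X 2) = 2 * X 0 - X 1 - X 2 := by
    linear_combination (X 1 + X 2 : MvPolynomial (Fin 3) K) * hCrel
  have hQ : (X 0 + C ω * X 1 + C ω ^ 2 * X 2 : MvPolynomial (Fin 3) K) *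
      (X 0 + C ω ^ 2 * X 1 + C ω * X 2) =
        X 0 ^ 2 + X 1 ^ 2 + X 2 ^ 2 - X 0 * X 1 - X 0 * X 2 - X 1 * X 2 := by
    linear_combination (X 0 * X 1 + X 0 * X 2 + X 1 ^ 2 * C ω - (X 1 ^ 2) + X 1 * X 2 * C ω ^ 2 - (X
    1 * X 2 * C ω) + X 1 * X 2 + X 2 ^ 2 * C ω - (X 2 ^ 2) : MvPolynomial (Fin 3) K) * hCrel
  simp only [map_add, map_sub, map_mul, map_pow, bind₁_X_right, toMvPolynomial_fin_three_c,
    Matrix.of_apply, Matrix.cons_val_zero, Matrix.cons_val_one, Matrix.cons_val_two,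
      Matrix.head_cons,
    Matrix.tail_cons, map_one, one_mul, map_ofNat, smul_eq_C_mul, map_neg]
  generalize (X 0 + C ω * X 1 + C ω ^ 2 * X 2 : MvPolynomial (Fin 3) K) = Y at hL hQ ⊢
  generalize (X 0 + C ω ^ 2 * X 1 + C ω * X 2 : MvPolynomial (Fin 3) K) = Z at hL hQ ⊢
  have r1 : Y ^ 3 * Z ^ 3 = (Y * Z) ^ 3 := by ring
  have r2 : Z ^ 4 * Y ^ 2 + Z ^ 2 * Y ^ 4 = (Y * Z) ^ 2 * ((Y + Z) ^ 2 - 2 * (Y * Z)) := by ring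
  have r3 : Z ^ 5 * Y + Z * Y ^ 5 =
      (Y * Z) * (((Y + Z) ^ 2 - 2 * (Y * Z)) ^ 2 - 2 * (Y * Z) ^ 2) := by ring
  have r4 : Z ^ 2 * Y + Z * Y ^ 2 = (Y * Z) * (Y + Z) := by ring
  have r5 : (X 0 + X 1 + X 2 : MvPolynomial (Fin 3) K) ^ 3 + Y ^ 3 + Z ^ 3 =
      (X 0 + X 1 + X 2) ^ 3 + ((Y + Z) ^ 3 - 3 * (Y * Z) * (Y + Z)) := by ring
  rw [r1, r2, r3, r4, r5, hL, hQ]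
  ring

end CuspidalSexticBasis

end Literature.AlgebraicGeometry.PlaneCurves
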